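import Summits.BirchSwinnertonDyer.BirchSwinnertonDyer.Theorems.RamifiedSevenEllipticUnitsRigidityFromPairs
import Summits.BirchSwinnertonDyer.BirchSwinnertonDyer.Theorems.RamifiedSevenEllipticUnitsTwistTransportPinned
import HarnessLib

set_option linter.dupNamespace false
set_option autoImplicit false

/-!
# Generator shape of an `L`-pinned Hecke character of type `(1,0)` — FROM THE PINNING ALONE

Helper file for the K7r Value crux `EllipticUnitValueSevenOfGZK` (stmt-BirchSwinnertonDyer-19945), line
`rubin-formula-zp` (skeleton v4.5 `2e480adc5d67667d`, cell `bsd-cm`, seat `bsd-cm-k7r-c2` g16; helper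
`--supports` 19945; THEOREMS ONLY, no named fact, nothing asserted).

WHAT. v4.5's registered PRINT stub `stub_printFactsHeckeDeuringGenSevenLine` displays Deuring's theorem
WITH GENERATOR VALUES (`Deuring_exists_heckeCharacter_of_maximalCM_withGenerators`, clause (vi):
`ψ(ϖ_w) = σ(α_w)` with `(α_w) = 𝔭_w` at the good primes — Silverman ATAEC II Thm. 9.1 (i) / Prop. 10.4),
because seat k7r-c2 g7's LEMMA Ξ reads the `7`-adic size of `ψ/ψ̄((α)) − 1 = α/ᾱ − 1` off that shape.
THIS FILE proves the generator shape is a THEOREM OF THE PINNING: for `K` imaginary quadratic with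
`𝓞_K` principal and ANY Hecke character `ψ` of infinity type `(1, 0)` with `L(ψ, s) = L(V, s)` on a right
half-plane for SOME Weierstrass curve `V/ℚ`, off a finite set of places `ψ` is unramified at `w` and
`ψ(ϖ_w) = σ(β_w)` for a generator `β_w` of `𝔭_w` (`σ` = the embedding of the infinite place). So clause
(vi) leaves the line's print trust base: the sequel file `…RubinPackageOfDeuring` re-assembles `S_pkg`
from PLAIN `Deuring_exists_heckeCharacter_of_maximalCM` (the tree's original fact).

MECHANISM (class-field-theory-free, density-free):
* §1 two algebraic lemmas: (a) `β₀^M = α^M` in `K` (`α ∈ 𝓞_K ∖ 0`, `M ≥ 1`) ⇒ `β₀ = ζ α` with `ζ` a root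
  of unity of `𝓞_K`, so `β₀ ∈ 𝓞_K` and `(β₀) = (α)`; (b) the QUADRATIC DESCENT: if `y² = a y − P` then
  `y^n = u_n y + v_n` with `u_n, v_n` polynomial in `a, P` — the same for both roots.
* §2 Neukirch (6.13) in seat k7r-c3's form `Rigidity.exists_finset_pow_rel` together with
  `Rigidity.coe_apply_infiniteIdeles_eq_of_hasInfinityType_one_zero` (`ψ((α)_∞) = σ(α)⁻¹`): at every
  principal place `𝔭_w = (α)` off the module of definition, `ψ(ϖ_w)^M = σ(α)^M`.
* §3 the pinning read at the unramified rational primes (seat k7r-c2 g13's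
  `TwistTransport.coeff_of_pinned_split` / `…_inert`, k7r-c3's `exists_places_eq_pair_or_eq_singleton`):
  at a split `ℓ = w₁ w₂`, `x = ψ(ϖ_{w₁})`, `x' = ψ(ϖ_{w₂})` have `x + x' = a_ℓ ∈ ℤ`, `x x' = a_ℓ² − a_{ℓ²} ∈ ℤ`;
  at an inert `ℓ`, `ψ(ϖ_w) = a_{ℓ²} ∈ ℤ`. DESCENT: `x^M = σ(u) x + σ(v)`; if `u ≠ 0` then `x ∈ σ(K)`, say
  `x = σ(β₀)`, and `β₀^M = α₁^M` gives (a); if `u = 0` then `x'^M = σ(v) = x^M`, so `σ(α₂)^M = σ(α₁)^M`,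
  `(α₁) = (α₂)`, `w₁ = w₂` — absurd. The inert case is (a) directly (`a_{ℓ²} ∈ ℤ ⊂ σ(K)`).
* §4 the cofinite generator shape, and its transport to `ψ ∘ c` (shape with `σ ∘ c`).

HONEST FRAMING: a kernel theorem about Hecke characters; no Literature `Prop` is a hypothesis here; it
discharges no stub by itself; BSD is not claimed for any curve; 19945 stays OPEN.

References: Neukirch, *Algebraic Number Theory* VII §6 (6.13)–(6.14), §8 (8.1); Silverman, ATAEC II
Prop. 10.4 (the statement recovered), Thm. 10.5 (b) (the pinning); Ribet 1977 §3 (coefficients of CM forms);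
cell texts STATUS 2026-08-27 D219/D222, k7r-c2 g16 12:41Z.
-/

noncomputable section

open scoped Classical
open Filter NumberField IsDedekindDomain WeierstrassCurve
  Literature.NumberTheory.GaloisRepresentations
  Literature.NumberTheory.EllipticCurves
  Literature.NumberTheory.EllipticCurves.ModularForms

namespace Summit.BirchSwinnertonDyer.BirchSwinnertonDyer.Theorems.RamifiedSevenEllipticUnits

namespace GeneratorShape

variable {K : Type} [Field K] [NumberField K]

/-! ## §1 Algebra: generators from equal powers; the quadratic descent -/

omit [NumberField K] in
/-- **Equal `M`-th powers give associated generators.** If `β₀ ∈ K`, `α ∈ 𝓞_K ∖ {0}` and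
`β₀^M = α^M` for some `M ≥ 1`, then `β₀/α` is a root of unity, hence a unit of `𝓞_K`: `β₀ ∈ 𝓞_K` and
`(β₀) = (α)`. [folklore] -/
theorem exists_generator_of_pow_eq {α : 𝓞 K} (hα : (α : K) ≠ 0) {β₀ : K} {M : ℕ} (hM : 0 < M)
    (h : β₀ ^ M = (α : K) ^ M) :
    ∃ β : 𝓞 K, (β : K) = β₀ ∧ Ideal.span {β} = Ideal.span {α} := by
  set u : K := β₀ / α with hu
  have huM : u ^ M = 1 := by rw [hu, div_pow, h, div_self (pow_ne_zero _ hα)]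
  have hint : IsIntegral ℤ u := IsIntegral.of_pow hM (by rw [huM]; exact isIntegral_one)
  set u' : 𝓞 K := ⟨u, hint⟩ with hu'def
  have hu' : (u' : K) = u := rfl
  have hu'M : u' ^ M = 1 := by
    apply RingOfIntegers.coe_injective
    simp only [map_pow, map_one]
    exact huM
  have hunit : IsUnit u' := IsUnit.of_pow_eq_one hu'M hM.ne'
  refine ⟨u' * α, ?_, Ideal.span_singleton_mul_left_unit hunit α⟩
  rw [RingOfIntegers.coe_eq_algebraMap, map_mul, ← RingOfIntegers.coe_eq_algebraMap,
    ← RingOfIntegers.coe_eq_algebraMap, hu', hu, div_mul_cancel₀ _ hα]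

omit [NumberField K] in
/-- **The quadratic descent.** For `a, P` in a commutative ring and every `n`, there are `u, v` in the
subring generated by `a, P` — here: in the image of a ring hom `σ` — with `y^n = u y + v` for EVERY `y`
satisfying `y² = a y − P`. [folklore] -/
theorem exists_pow_eq_linear (σ : K →+* ℂ) (a P : K) (n : ℕ) :
    ∃ u v : K, ∀ y : ℂ, y ^ 2 = σ a * y - σ P → y ^ n = σ u * y + σ v := by
  induction n with
  | zero => exact ⟨0, 1, fun y _ ↦ by simp⟩
  | succ n ih =>
    obtain ⟨u, v, huv⟩ := ih
    refine ⟨u * a + v, -(u * P), fun y hy ↦ ?_⟩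
    rw [pow_succ, huv y hy, add_mul, mul_assoc, ← pow_two, hy, map_add, map_mul, map_neg, map_mul]
    ring


omit [NumberField K] in
/-- **The split descent.** Two roots `x, x'` of the same quadratic `y² = σ(a) y − σ(P)` with `x^M = σ(α₁)^M`,
`x'^M = σ(α₂)^M` for NON-associated `α₁, α₂ ∈ 𝓞_K ∖ {0}`: then `x = σ(β)` for a generator `β` of `(α₁)`.
(Descent `y^M = σ(u) y + σ(v)`: `u ≠ 0` puts `x` in `σ(K)`; `u = 0` would force `σ(α₁)^M = σ(α₂)^M`,
i.e. `(α₁) = (α₂)`.) [folklore] -/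
theorem exists_generator_of_split (σ : K →+* ℂ) {α₁ α₂ : 𝓞 K} (hα₁ : (α₁ : K) ≠ 0)
    (hne : Ideal.span {α₁} ≠ Ideal.span {α₂}) {M : ℕ} (hM : 0 < M) {x x' : ℂ}
    (r₁ : x ^ M = σ (α₁ : K) ^ M) (r₂ : x' ^ M = σ (α₂ : K) ^ M) {a P : K}
    (hq : x ^ 2 = σ a * x - σ P) (hq' : x' ^ 2 = σ a * x' - σ P) :
    ∃ β : 𝓞 K, Ideal.span {β} = Ideal.span {α₁} ∧ x = σ (β : K) := by
  obtain ⟨u, v, huv⟩ := exists_pow_eq_linear σ a P M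
  have ex := huv x hq
  have ex' := huv x' hq'
  by_cases hu : u = 0
  · exfalso
    rw [hu, map_zero, zero_mul, zero_add] at ex ex'
    have h12 : ((α₂ : K)) ^ M = (α₁ : K) ^ M :=
      σ.injective (by rw [map_pow, map_pow, ← r₁, ← r₂, ex, ex'])
    obtain ⟨β, hβ, hspan⟩ := exists_generator_of_pow_eq hα₁ hM h12
    have hβ₂ : β = α₂ := RingOfIntegers.coe_injective hβ
    exact hne (by rw [← hspan, hβ₂])
  · have hσu : σ u ≠ 0 := (map_ne_zero σ).mpr hu
    set β₀ : K := ((α₁ : K) ^ M - v) / u with hβ₀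
    have hx : x = σ β₀ := by
      rw [hβ₀, map_div₀, map_sub, map_pow, eq_div_iff hσu, ← r₁, ex]
      ring
    have hβM : β₀ ^ M = (α₁ : K) ^ M := σ.injective (by rw [map_pow, ← hx, r₁, map_pow])
    obtain ⟨β, hβ, hspan⟩ := exists_generator_of_pow_eq hα₁ hM hβM
    exact ⟨β, hspan, by rw [hx, ← hβ]⟩

omit [NumberField K] in
/-- **The rational case.** If `x = σ(b)` for some `b ∈ K` and `x^M = σ(α)^M`, then `x = σ(β)` for a
generator `β` of `(α)`. [folklore] -/
theorem exists_generator_of_mem (σ : K →+* ℂ) {α : 𝓞 K} (hα : (α : K) ≠ 0) {M : ℕ} (hM : 0 < M)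
    {x : ℂ} (r : x ^ M = σ (α : K) ^ M) {b : K} (hx : x = σ b) :
    ∃ β : 𝓞 K, Ideal.span {β} = Ideal.span {α} ∧ x = σ (β : K) := by
  have hβM : b ^ M = (α : K) ^ M := σ.injective (by rw [map_pow, ← hx, r, map_pow])
  obtain ⟨β, hβ, hspan⟩ := exists_generator_of_pow_eq hα hM hβM
  exact ⟨β, hspan, by rw [hx, ← hβ]⟩

/-! ## §2 Neukirch (6.13) at a principal place, infinity type `(1, 0)` -/

/-- **`ψ(ϖ_w)^M = σ(α)^M` at a principal place `𝔭_w = (α)` off the module of definition**, for `ψ` of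
infinity type `(1, 0)` on an imaginary quadratic field (`σ = w₀.embedding`): seat k7r-c3's
`Rigidity.exists_finset_pow_rel` (`(ψ((α)_∞) ψ(ϖ_w))^M = 1`) with `ψ((α)_∞) = σ(α)⁻¹`
(`Rigidity.coe_apply_infiniteIdeles_eq_of_hasInfinityType_one_zero`).
[cite: NeukirchANT1999, Ch. VII §6 Prop. (6.13) and Cor. (6.14)] -/
theorem exists_finset_pow_eq_pow (hK : IsImaginaryQuadratic K) (w₀ : InfinitePlace K)
    {ψ : HeckeCharacter K} (hinf : ψ.HasInfinityType (fun _ ↦ 1) (fun _ ↦ 0)) :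
    ∃ (T : Finset (HeightOneSpectrum (𝓞 K))) (M : ℕ), 0 < M ∧ (∀ w ∉ T, ψ.IsUnramifiedAt w) ∧
      ∀ {w : HeightOneSpectrum (𝓞 K)}, w ∉ T → ∀ {α : 𝓞 K}, (α : K) ≠ 0 →
        w.asIdeal = Ideal.span {α} →
          ψ.valueAtUniformizer w ^ M = (w₀.embedding (α : K)) ^ M := by
  obtain ⟨T, M, hM, hur, hrel⟩ := Rigidity.exists_finset_pow_rel ψ
  refine ⟨T, M, hM, hur, fun {w} hw {α} hα hspan ↦ ?_⟩
  have h := hrel hw hα 1 (by rw [pow_one, hspan])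
  rw [Rigidity.coe_apply_infiniteIdeles_eq_of_hasInfinityType_one_zero hK w₀ hinf, Units.val_mk0,
    pow_one, mul_pow, inv_pow] at h
  have hz : (w₀.embedding (α : K)) ^ M ≠ 0 := pow_ne_zero _ ((map_ne_zero _).mpr hα)
  rwa [inv_mul_eq_one₀ hz, eq_comm] at h

/-! ## §3 The generator shape off a finite set of places -/

/-- The places of `K` above the rational place `v` all contain `ℓ_v`, so they are finitely many. [folklore] -/
theorem finite_setOf_under_eq (v : HeightOneSpectrum (𝓞 ℚ)) :
    {w : HeightOneSpectrum (𝓞 K) | w.under (𝓞 ℚ) = v}.Finite := by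
  have hℓ : (Ideal.span {((Rat.HeightOneSpectrum.natGenerator v : ℕ) : 𝓞 K)} : Ideal (𝓞 K)) ≠ ⊥ := by
    rw [Ne, Ideal.span_singleton_eq_bot]
    exact_mod_cast (Rat.HeightOneSpectrum.prime_natGenerator v).ne_zero
  refine (Ideal.finite_factors hℓ).subset fun w hw ↦ ?_
  have hw' : w.asIdeal.under (𝓞 ℚ) = v.asIdeal := by
    rw [← HeightOneSpectrum.under_asIdeal]
    exact congrArg HeightOneSpectrum.asIdeal hw
  exact (Ideal.dvd_span_singleton).mpr ((asIdeal_under_eq_iff_natCast_mem v w).mp hw')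

/-- **GENERATOR SHAPE FROM THE PINNING.** Let `K` be imaginary quadratic with `𝓞_K` principal, `ψ` a Hecke
character of `K` of infinity type `(1, 0)` with `L(ψ, s) = L(V, s)` (`re s > s₀`) for some Weierstrass curve
`V/ℚ`. Then at all but finitely many finite places `w`: `ψ` is unramified at `w` and
`ψ(ϖ_w) = σ(β_w)` for some generator `β_w` of `𝔭_w` (`σ = w₀.embedding`). This is the printed statement of
Silverman ATAEC II Prop. 10.4 («`ψ_{E/L}(𝔓) = α_{E/L}(x) ∈ R_K`», `(α) = N 𝔓`) for the Grössencharacter of a CM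
curve — obtained here for every pinned `(1, 0)` character, from §2 and the pinning read at the unramified
rational primes (split: `x + x' = a_ℓ`, `x x' = a_ℓ² − a_{ℓ²}`; inert: `x = a_{ℓ²}`), by the descent of §1.
[cite: SilvermanATAEC1994, Ch. II Prop. 10.4 and Cor. 10.4.1 (a) (the statement; shape only)]
[cite: NeukirchANT1999, Ch. VII §6 Prop. (6.13), §8 (8.1)] [cite: Ribet1977Nebentypus, §3 Thm. (3.4)] -/
theorem eventually_exists_generator_of_pinned (hK : IsImaginaryQuadratic K) [IsPrincipalIdealRing (𝓞 K)]
    (w₀ : InfinitePlace K) {ψ : HeckeCharacter K} (hinf : ψ.HasInfinityType (fun _ ↦ 1) (fun _ ↦ 0))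
    (V : WeierstrassCurve ℚ) (s₀ : ℝ) (hpin : ∀ s : ℂ, s₀ < s.re → heckeLFunction ψ s = V.LSeries s) :
    ∀ᶠ w : HeightOneSpectrum (𝓞 K) in cofinite,
      ψ.IsUnramifiedAt w ∧ ∃ β : 𝓞 K, Ideal.span {β} = w.asIdeal ∧
        ψ.valueAtUniformizer w = w₀.embedding (β : K) := by
  have h2 : Module.finrank ℚ K = 2 := hK.1
  set σ : K →+* ℂ := w₀.embedding with hσ
  obtain ⟨T, M, hM, hur, hrel⟩ := exists_finset_pow_eq_pow hK w₀ hinf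
  -- exceptional places (1): those sharing their rational prime with a place of `T`
  set π : HeightOneSpectrum (𝓞 K) → HeightOneSpectrum (𝓞 ℚ) := fun w ↦ w.under (𝓞 ℚ) with hπ
  have hT' : ∀ᶠ w : HeightOneSpectrum (𝓞 K) in cofinite,
      ∀ w' : HeightOneSpectrum (𝓞 K), π w' = π w → w' ∉ T := by
    have hfin : (π ⁻¹' ((T.image π : Finset (HeightOneSpectrum (𝓞 ℚ))) :
        Set (HeightOneSpectrum (𝓞 ℚ)))).Finite :=
      (T.image π).finite_toSet.preimage' fun v _ ↦ finite_setOf_under_eq v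
    refine Filter.eventually_cofinite.2 (hfin.subset fun w hw ↦ ?_)
    simp only [Set.mem_setOf_eq, not_forall, not_not, exists_prop] at hw
    obtain ⟨w', hw'w, hw'T⟩ := hw
    simp only [Set.mem_preimage, Finset.coe_image, Set.mem_image, Finset.mem_coe]
    exact ⟨w', hw'T, hw'w⟩
  -- exceptional places (2): those above the primes dividing `d_K`
  set d : 𝓞 K := ((NumberField.discr K : ℤ) : 𝓞 K) with hd
  have hd0 : d ≠ 0 := by
    rw [hd]
    exact_mod_cast NumberField.discr_ne_zero K
  have hD : ∀ᶠ w : HeightOneSpectrum (𝓞 K) in cofinite, d ∉ w.asIdeal := by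
    have hfin : {w : HeightOneSpectrum (𝓞 K) | w.asIdeal ∣ Ideal.span {d}}.Finite :=
      Ideal.finite_factors ((Ideal.span_singleton_eq_bot.not).mpr hd0)
    refine Filter.eventually_cofinite.2 (hfin.subset fun w hw ↦ ?_)
    simp only [Set.mem_setOf_eq, not_not] at hw
    exact (Ideal.dvd_span_singleton).mpr hw
  filter_upwards [hT', hD] with w hTw hdw
  refine ⟨hur w (hTw w rfl), ?_⟩
  -- the rational prime `ℓ` under `w` is unramified in `K`
  set v : HeightOneSpectrum (𝓞 ℚ) := w.under (𝓞 ℚ) with hv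
  have hwv : w.asIdeal.under (𝓞 ℚ) = v.asIdeal := rfl
  set ℓ : ℕ := Rat.HeightOneSpectrum.natGenerator v with hℓ
  have hℓw : ((ℓ : ℕ) : 𝓞 K) ∈ w.asIdeal := (asIdeal_under_eq_iff_natCast_mem v w).mp hwv
  have hnd : ¬ (Rat.HeightOneSpectrum.natGenerator v : ℤ) ∣ NumberField.discr K := by
    rintro ⟨k, hk⟩
    apply hdw
    have : d = ((ℓ : ℕ) : 𝓞 K) * ((k : ℤ) : 𝓞 K) := by
      rw [hd, hk]; push_cast; rfl
    rw [this]
    exact Ideal.mul_mem_right _ _ hℓw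
  have he : v.asIdeal.ramificationIdxIn (𝓞 K) = 1 := ramificationIdxIn_eq_one_of_not_dvd_discr K v hnd
  -- a place above `v` is off `T`
  have hoff : ∀ w' : HeightOneSpectrum (𝓞 K), w'.asIdeal.under (𝓞 ℚ) = v.asIdeal → w' ∉ T :=
    fun w' hw' ↦ hTw w' (HeightOneSpectrum.ext (by rw [HeightOneSpectrum.under_asIdeal]; exact hw'))
  -- generators of principal places and their non-vanishing
  have hgen : ∀ w' : HeightOneSpectrum (𝓞 K), ∃ α : 𝓞 K, (α : K) ≠ 0 ∧ w'.asIdeal = Ideal.span {α} := by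
    intro w'
    obtain ⟨α, hα⟩ := Submodule.IsPrincipal.principal w'.asIdeal
    rw [Ideal.submodule_span_eq] at hα
    refine ⟨α, fun h0 ↦ w'.ne_bot ?_, hα⟩
    rw [hα, Ideal.span_singleton_eq_bot]
    exact_mod_cast h0
  rcases exists_places_eq_pair_or_eq_singleton h2 v he with
    ⟨w₁, w₂, hne, hS, h₁, h₂⟩ | ⟨w₁, hS, hw₁⟩
  · -- SPLIT: `ℓ = w₁ w₂`
    have hm₁ : w₁.asIdeal.under (𝓞 ℚ) = v.asIdeal := by
      have : w₁ ∈ {w' : HeightOneSpectrum (𝓞 K) | w'.asIdeal.under (𝓞 ℚ) = v.asIdeal} := by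
        rw [hS]; exact Set.mem_insert _ _
      exact this
    have hm₂ : w₂.asIdeal.under (𝓞 ℚ) = v.asIdeal := by
      have : w₂ ∈ {w' : HeightOneSpectrum (𝓞 K) | w'.asIdeal.under (𝓞 ℚ) = v.asIdeal} := by
        rw [hS]; exact Set.mem_insert_of_mem _ rfl
      exact this
    have hT₁ : w₁ ∉ T := hoff w₁ hm₁
    have hT₂ : w₂ ∉ T := hoff w₂ hm₂
    obtain ⟨α₁, hα₁0, hα₁⟩ := hgen w₁
    obtain ⟨α₂, hα₂0, hα₂⟩ := hgen w₂
    have hne₁₂ : Ideal.span {α₁} ≠ Ideal.span {α₂} := fun h ↦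
      hne (HeightOneSpectrum.ext (by rw [hα₁, hα₂, h]))
    have r₁ := hrel hT₁ hα₁0 hα₁
    have r₂ := hrel hT₂ hα₂0 hα₂
    -- the pinning read at the split prime
    obtain ⟨hsum, hsq⟩ :=
      TwistTransport.coeff_of_pinned_split ψ V s₀ hpin v hne hS h₁ h₂ (hur _ hT₁) (hur _ hT₂)
    set x := ψ.valueAtUniformizer w₁ with hx
    set x' := ψ.valueAtUniformizer w₂ with hx'
    set A : ℤ := V.LFunction ℓ with hA
    set P : ℤ := A ^ 2 - V.LFunction (ℓ ^ 2) with hP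
    have hxa : x + x' = σ ((A : ℤ) : K) := by rw [map_intCast, hA, hℓ, hsum]
    have hxP : x * x' = σ ((P : ℤ) : K) := by
      rw [map_intCast, hP, hA, hℓ]; push_cast; rw [hsum, hsq]; ring
    have hq : x ^ 2 = σ ((A : ℤ) : K) * x - σ ((P : ℤ) : K) := by rw [← hxa, ← hxP]; ring
    have hq' : x' ^ 2 = σ ((A : ℤ) : K) * x' - σ ((P : ℤ) : K) := by rw [← hxa, ← hxP]; ring
    -- `w` is `w₁` or `w₂`
    have hwS : w ∈ {w' : HeightOneSpectrum (𝓞 K) | w'.asIdeal.under (𝓞 ℚ) = v.asIdeal} := hwv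
    rw [hS] at hwS
    rcases hwS with rfl | rfl
    · obtain ⟨β, hspan, hxβ⟩ := exists_generator_of_split σ hα₁0 hne₁₂ hM r₁ r₂ hq hq'
      exact ⟨β, by rw [hspan, hα₁], hxβ⟩
    · obtain ⟨β, hspan, hxβ⟩ := exists_generator_of_split σ hα₂0 hne₁₂.symm hM r₂ r₁ hq' hq
      exact ⟨β, by rw [hspan, hα₂], hxβ⟩
  · -- INERT: `w = w₁`, `ψ(ϖ_w) = a_{ℓ²} ∈ ℤ`
    have hwS : w ∈ {w' : HeightOneSpectrum (𝓞 K) | w'.asIdeal.under (𝓞 ℚ) = v.asIdeal} := hwv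
    rw [hS, Set.mem_singleton_iff] at hwS
    subst hwS
    have hT₁ : w ∉ T := hTw w rfl
    obtain ⟨α, hα0, hα⟩ := hgen w
    have r := hrel hT₁ hα0 hα
    have hval := TwistTransport.coeff_of_pinned_inert ψ V s₀ hpin v hS hw₁ (hur _ hT₁)
    have hxb : ψ.valueAtUniformizer w = σ (((V.LFunction (ℓ ^ 2) : ℤ)) : K) := by
      rw [map_intCast, hℓ, hval]
    obtain ⟨β, hspan, hxβ⟩ := exists_generator_of_mem σ hα0 hM r hxb
    exact ⟨β, by rw [hspan, hα], hxβ⟩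

/-! ## §4 The shape in LEMMA Ξ's currency, and its transport to `ψ ∘ c` -/

/-- **The generator shape of a pinned `(1, 0)` character, as consumed by LEMMA Ξ**
(`RubinPadicLFunctionData.ξ_eq_φac_and_norm_sq_of_frame`, hypothesis `hvals`): off a finite set of places,
`ψ` is unramified with `ψ(ϖ_w) = σ(α)`, `(α) = 𝔭_w`, `σ = w₀.embedding`.
[cite: SilvermanATAEC1994, Ch. II Prop. 10.4 (the statement; shape only)] [cite: NeukirchANT1999, Ch. VII §6 Prop. (6.13)] -/
theorem shape_of_pinned (hK : IsImaginaryQuadratic K) [IsPrincipalIdealRing (𝓞 K)]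
    (w₀ : InfinitePlace K) {ψ : HeckeCharacter K} (hinf : ψ.HasInfinityType (fun _ ↦ 1) (fun _ ↦ 0))
    (V : WeierstrassCurve ℚ) (s₀ : ℝ) (hpin : ∀ s : ℂ, s₀ < s.re → heckeLFunction ψ s = V.LSeries s) :
    ∃ S : Set (HeightOneSpectrum (𝓞 K)), S.Finite ∧ ∀ w ∉ S,
      ψ.IsUnramifiedAt w ∧ ∃ α : 𝓞 K, Ideal.span {α} = w.asIdeal ∧
        ψ.valueAtUniformizer w = w₀.embedding (α : K) := by
  have h := eventually_exists_generator_of_pinned hK w₀ hinf V s₀ hpin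
  rw [Filter.eventually_cofinite] at h
  refine ⟨_, h, fun w hw ↦ ?_⟩
  simp only [Set.mem_setOf_eq, not_not] at hw
  exact hw

/-- **Transport of the shape to `ψ ∘ c` with the conjugate embedding `σ ∘ c`** (cofinite form of
`RubinPackageOfRigidity.deuringValues_galConj`): `ψ` conj-equivariant, `K` quadratic, `σ` non-real.
[cite: SilvermanATAEC1994, Ch. II Thm. 9.2 and Cor. 10.4.1 (a) (shape only)] -/
theorem shape_galConj (h2 : Module.finrank ℚ K = 2) {c : K ≃ₐ[ℚ] K} (hc : c ≠ 1)
    {ψ : HeckeCharacter K} (heq : IsHeckeConjEquivariant c ψ) (σ : K →+* ℂ)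
    (hσr : ¬ ComplexEmbedding.IsReal σ)
    (h : ∃ S : Set (HeightOneSpectrum (𝓞 K)), S.Finite ∧ ∀ w ∉ S,
      ψ.IsUnramifiedAt w ∧ ∃ α : 𝓞 K, Ideal.span {α} = w.asIdeal ∧ ψ.valueAtUniformizer w = σ (α : K)) :
    ∃ S : Set (HeightOneSpectrum (𝓞 K)), S.Finite ∧ ∀ w ∉ S,
      (HeckeCharacter.galConj c ψ).IsUnramifiedAt w ∧ ∃ α : 𝓞 K, Ideal.span {α} = w.asIdeal ∧
        (HeckeCharacter.galConj c ψ).valueAtUniformizer w = (σ.comp (c : K →+* K)) (α : K) := by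
  obtain ⟨S, hS, hSw⟩ := h
  refine ⟨S, hS, fun w hw ↦ ?_⟩
  obtain ⟨hur, α, hα, hv⟩ := hSw w hw
  refine ⟨(heq.isUnramifiedAt_galConj_iff' w).2 hur, α, hα, ?_⟩
  rw [heq.valueAtUniformizer_galConj', hv, RingHom.coe_comp, Function.comp_apply,
    LemmaXi.conj_embedding_eq_embedding_algEquiv h2 c hc σ hσr]
  rfl

end GeneratorShape


end Summit.BirchSwinnertonDyer.BirchSwinnertonDyer.Theorems.RamifiedSevenEllipticUnits

end
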